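/-
Copyright (c) 2026 the pub-hodgecm-mathlib formalisation cell (harness21).  Prover seat hodgecm-mathlib-K2E1-p14 (g5), R90-TF section S8 «ContSpec-n½» (dealer R90-CS-plan (g3),
S8-R222 (b) pre-deal «(3)(ii) LOCAL↔GLOBAL BOREL BRIDGE `u ∈ B_f·K_f(𝔫)` ⟺ ∀ v, `u_v ∈ B_v·K_v(𝔫)` over ★ `finAdelicEquiv`∕`evalPlace`», S8-R226 (1);
census `K2/K2E1-p14/g5/CENSUS-F1-FinAdelicBorelLevelLocalGlobal.K2E1-p14-g5.md`): letter (3)(ii) of the `hsrc` core of R90-CS-p03 (g3)'s ★ p864589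
`K2E1ChiMidBlockUnfoldingAtBasePointU3.exists_pos_middleCoefficient_basePoint_eq_chiEulerProduct` (the pure-tensor reading `hΩ` of the finite witness section).
-/
import Literature.NumberTheory.Automorphic.UnitaryGroupCongruenceLevels   -- ★ `finCongruenceLevel`, `mem_finCongruenceLevel_iff_forall`; brings ★ `finAdelicEquiv`, `evalPlace`, `localPi`, `localInt`
import Literature.NumberTheory.Automorphic.UnitaryGroupBorelPair         -- ★ `borelAdelic`, `mem_borelAdelic_iff`
import HarnessLib

/-!
# K2·E1 ∕ R90·S8 — `K2E1FinAdelicBorelLevelLocalGlobalU3`: `u ∈ B_f·K_f(𝔫)` IFF `u_v ∈ B_v·K_v(𝔫)` AT EVERY FINITE PLACE `v` OF `F` (restricted-product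
# assembly of a finite-adelic Borel element of the quasi-split unitary group)

Cell `pub/hodgecm-mathlib`, crux h413 = `stmt-HodgeConjecture-24833`, route of record `HCCMUnconditional`; R90-TF section S8 «ContSpec-n½», road R2-χ₃ ((V)∕(R)′ OF RECORD row (iii) `hsrc`;
ruling J-S8-UNF: the adelic unfolding is ★, the L core of `hsrc` is the PURE-TENSOR READING of the finite witness section `Φf = θ(b)·𝟙_{B_f·K_f(𝔫)}` (★ p864219 (E-supp)) — (3)(i) `finPart`
plumbing, **(3)(ii) THIS FILE**, (3)(iii) character factorisation `θ = ∏_v θ_v` (K2E1-p11)).  THEOREMS ONLY (no `def`, no `instance`, no notation, no named-fact hypothesis, no `sorry`; default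
heartbeats); lane `--supports stmt-HodgeConjecture-24833 --as helper` (count-neutral).  Closes no socket.

THE MATHEMATICS ([PlatonovRapinchuk1994] §5.1; [BorelJacquet1979] §4.1; [CasselsFrohlichANT1967] Ch. II §§13–14).  `E/F` number fields, `c ∈ Aut(E/F)`, `U = U(J_N)` Mok's quasi-split unitary
group, `U(𝔸_{F,f}) = ∏'_v U(F_v)` (★ `finAdelicEquiv`, components `u_v = evalPlace v u ∈ U(F_v) ≤ Π_{w∣v} GL_N(E_w)`).  GLOBAL: `B_f := ι_f⁻¹ B(𝔸_F)` (★ `borelAdelic`: the adelic matrix is upper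
triangular) and `K_f(𝔫) := U(𝔸_{F,f}) ∩ K(𝔫)` (★ `finCongruenceLevel 𝔫`, placewise `k_w ∈ K_w(|𝔫|_w)` = ★ `valuedCongruenceSubgroup (Fin N) (idealRadius E w 𝔫)`).  LOCAL, INSIDE THE UNITARY
FACTOR `U(F_v)` (not inside `GL_N(E_w)` — a `w`-by-`w` Borel of `GL_N` would not reassemble to a unitary element): `B_v := {β ∈ U(F_v) : β_w upper triangular ∀ w ∣ v}`,
`K_v(𝔫) := {κ ∈ U(F_v) : κ_w ∈ K_w(|𝔫|_w) ∀ w ∣ v}`.  THEN **`u ∈ B_f·K_f(𝔫) ⟺ ∀ v, u_v ∈ B_v·K_v(𝔫)`**.  «⇒»: components of `b` and `k`.  «⇐»: choose `u_v = β_v κ_v` at every `v`;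
since `κ_v ∈ K_v(𝔫) ≤ U(𝒪_v)` and `u_v ∈ U(𝒪_v)` for almost all `v`, `(β_v)_v` lies in the restricted product, so `b := finAdelicEquiv⁻¹ (β_v)_v ∈ U(𝔸_{F,f})` with `ι_f b ∈ B(𝔸_F)`, and
`k := b⁻¹ u` has components `κ_v`, i.e. `k ∈ K_f(𝔫)`.  No hypothesis on `𝔫`.  For `𝔫 ≠ 0` moreover `u_v ∈ K_v(𝔫)` for almost all `v` (★ `Ideal.finite_factors`, `|𝔫|_w = 1` off `𝔫`,
`GL_N(𝒪_w) = K_w(1)`), so the `{0,1}`-indicator of `B_f·K_f(𝔫)` is the FINITE product `∏ᶠ_v` of the local indicators — the support factor of the consumer's `hΩ` (★ p864589 :139).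
* §1 `finAdelicToAdelic_mem_borelAdelic_iff` (`ι_f b ∈ B(𝔸)` iff the finite-adelic matrix of `b` is upper triangular), `…_iff_forall_evalAt` (iff every `b_w` is), `…_iff_forall_evalPlace` (iff every `(b_v)_w` is).
* §2 `mem_finCongruenceLevel_iff_forall_evalPlace` — ★ `mem_finCongruenceLevel_iff_forall` re-indexed over the places `v` of `F` and `w ∣ v` (general form `J`).
* §3 «⇒» `forall_exists_borel_mul_level_of_eq_mul`; §4 «⇐» `exists_borel_mul_level_evalPlace_eq` (restricted-product assembly WITH PRESCRIBED COMPONENTS `b_v = β_v`, `k_v = κ_v` — the global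
  Borel factor reads the chosen local Iwasawa data, which (3)(iii) evaluates), `exists_borel_mul_level_of_forall` (existential form); tools `evalPlace_finAdelicEquiv_symm`, `valuedCongruenceSubgroup_le_glInt`.
* §5 HEAD **`exists_borel_mul_level_iff_forall_evalPlace`** and its (supp-off) twin `forall_ne_borel_mul_level_iff_exists_place` ((E-supp)'s letters verbatim on the left).
* §6 (`𝔫 ≠ 0`) `eventually_forall_evalPlace_mem_valuedCongruenceSubgroup`, `eventually_exists_borel_mul_level_evalPlace`, and the indicator factorisation `ite_exists_borel_mul_level_eq_finprod`.
* §7 the CM `N = 3` heads at the S8 tokens (`F = L⁺ = maximalRealSubfield L`, `c` = complex conjugation): `exists_borel_mul_level_iff_forall_evalPlace_cm_three`, `ite_exists_borel_mul_level_eq_finprod_cm_three`.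
HONEST LABEL: HC_CM is proved only modulo the 7 printed citations (2 remaining named inputs: hLiu418 = `stmt-HodgeConjecture-24832`, h413 = `stmt-HodgeConjecture-24833`) until rung 0
closes; REL ≠ ★ ≠ BUILT; this file asserts no named fact and closes no socket; unconditional restricted-product plumbing; `hsrc` stays ★ modulo {(3)(i), (3)(iii), `hfin`}; count-neutral.

## References
* [PlatonovRapinchuk1994] V. Platonov, A. Rapinchuk, *Algebraic Groups and Number Theory* (1994), §5.1 (`G_𝔸 = ∏'_v (G_{F_v} : G_{𝒪_v})`, congruence subgroups).
* [BorelJacquet1979] A. Borel, H. Jacquet, *Automorphic forms and automorphic representations*, PSPM 33.1 (1979), §4.1 (`G(𝔸_f) = ∏'_v G(F_v)`, `P(𝔸)`, levels).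
* [CasselsFrohlichANT1967] J. W. S. Cassels, A. Fröhlich (eds.), *Algebraic Number Theory* (1967), Ch. II §§13–14 (restricted topological products).
-/

set_option autoImplicit false
set_option linter.dupNamespace false -- the mandated namespace repeats `HodgeConjecture.HodgeConjecture`

noncomputable section

open NumberField IsDedekindDomain Filter
open scoped RestrictedProduct
open Literature.NumberTheory.Automorphic Literature.NumberTheory.Automorphic.UnitaryGroup

namespace Summit.HodgeConjecture.HodgeConjecture.Cruxes.H413.K2E1FinAdelicBorelLevelLocalGlobalU3

section General

variable (F E : Type) [Field F] [NumberField F] [Field E] [NumberField E] [Algebra F E] (c : E ≃ₐ[F] E) (N : ℕ)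

/-! ## §0 Two local dictionary lemmas: `K_w(c) ≤ GL_N(𝒪_w) = K_w(1)` -/

/-- `x ∈ 𝒪[E_w]` (valuation ring of the `ValuativeRel` structure, the integers of ★ `glInt`) iff `|x|_w ≤ 1` (Mathlib's `Valued.v`). [folklore] -/
theorem mem_integer_iff_valued_le_one (w : HeightOneSpectrum (𝓞 E)) (x : w.adicCompletion E) :
    x ∈ (ValuativeRel.valuation (w.adicCompletion E)).integer ↔ Valued.v x ≤ 1 := by
  rw [Valuation.mem_integer_iff]
  exact (ValuativeRel.isEquiv (ValuativeRel.valuation (w.adicCompletion E)) (Valued.v : Valuation (w.adicCompletion E) _)).le_one_iff_le_one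

/-- **`K_w(r) ≤ GL_N(𝒪_w)`** for every radius `r`: a member of the valued congruence subgroup has integral entries and integral inverse. [cite: PlatonovRapinchuk1994, §5.1] -/
theorem valuedCongruenceSubgroup_le_glInt (w : HeightOneSpectrum (𝓞 E)) (r : WithZero (Multiplicative ℤ)) :
    valuedCongruenceSubgroup (F := w.adicCompletion E) (Fin N) r ≤ glInt N (w.adicCompletion E) := by
  rintro g ⟨h₁, h₂, -⟩
  rw [mem_glInt_iff]
  exact ⟨fun i j => (mem_integer_iff_valued_le_one E w _).2 (h₁ i j), fun i j => (mem_integer_iff_valued_le_one E w _).2 (h₂ i j)⟩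

/-- **`GL_N(𝒪_w) ≤ K_w(1)`**: an integral matrix with integral inverse is `≡ 1` to radius `1` (ultrametric inequality). [cite: PlatonovRapinchuk1994, §5.1] -/
theorem glInt_le_valuedCongruenceSubgroup_one (w : HeightOneSpectrum (𝓞 E)) :
    glInt N (w.adicCompletion E) ≤ valuedCongruenceSubgroup (F := w.adicCompletion E) (Fin N) (1 : WithZero (Multiplicative ℤ)) := by
  intro g hg
  rw [mem_glInt_iff] at hg
  obtain ⟨h₁, h₂⟩ := hg
  refine ⟨fun i j => (mem_integer_iff_valued_le_one E w _).1 (h₁ i j), fun i j => (mem_integer_iff_valued_le_one E w _).1 (h₂ i j), fun i j => ?_⟩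
  rw [Matrix.sub_apply]
  refine (Valuation.map_sub _ _ _).trans (max_le ((mem_integer_iff_valued_le_one E w _).1 (h₁ i j)) ?_)
  rw [Matrix.one_apply]
  split_ifs <;> simp

/-! ## §1 `ι_f b ∈ B(𝔸_F)` is a placewise condition -/

/-- **`ι_f b ∈ B(𝔸_F)` iff the finite-adelic matrix of `b` is upper triangular** (the archimedean component of `ι_f b = (1, b)` is `1`; entries of `(1, b)` are `(δ_{ij}, b_{ij})`, ★
`GLn.coe_ofFinite_apply`). [cite: BorelJacquet1979, §4.1] -/
theorem finAdelicToAdelic_mem_borelAdelic_iff (b : finAdelic F E c N ((StdForm.antidiagonal N).over E)) :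
    finAdelicToAdelic F E c N ((StdForm.antidiagonal N).over E) b ∈ borelAdelic F E c N ↔
      ((b : GL (Fin N) (FiniteAdeleRing (𝓞 E) E)) : Matrix (Fin N) (Fin N) (FiniteAdeleRing (𝓞 E) E)).BlockTriangular id := by
  rw [mem_borelAdelic_iff, adelicVal_finAdelicToAdelic]
  constructor
  · intro h i j hij
    have hz := h hij
    rw [GLn.coe_ofFinite_apply] at hz
    exact (Prod.mk_eq_zero.1 hz).2
  · intro h i j hij
    rw [GLn.coe_ofFinite_apply, h hij, Matrix.one_apply_ne (ne_of_gt (show j < i from hij))]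
    rfl

/-- **`ι_f b ∈ B(𝔸_F)` iff every local component `b_w ∈ GL_N(E_w)` (`w` a finite place of `E`) is upper triangular** (a finite adele vanishes iff all its components do). [cite: PlatonovRapinchuk1994, §5.1] -/
theorem finAdelicToAdelic_mem_borelAdelic_iff_forall_evalAt (b : finAdelic F E c N ((StdForm.antidiagonal N).over E)) :
    finAdelicToAdelic F E c N ((StdForm.antidiagonal N).over E) b ∈ borelAdelic F E c N ↔
      ∀ w : HeightOneSpectrum (𝓞 E), ((GLn.evalAt N E w (b : GL (Fin N) (FiniteAdeleRing (𝓞 E) E)) : GL (Fin N) (w.adicCompletion E)) :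
        Matrix (Fin N) (Fin N) (w.adicCompletion E)).BlockTriangular id := by
  rw [finAdelicToAdelic_mem_borelAdelic_iff]
  constructor
  · intro h w i j hij
    rw [GLn.coe_evalAt_apply, h hij]
    rfl
  · intro h i j hij
    exact FiniteAdeleRing.ext E fun w => by rw [← GLn.coe_evalAt_apply, h w hij]; rfl

/-- **`ι_f b ∈ B(𝔸_F)` iff for every finite place `v` of `F` and every `w ∣ v` the `w`-component of `b_v = evalPlace v b ∈ U(F_v)` is upper triangular** (§1 re-indexed along `w ↦ w ∩ 𝓞_F`; ★
`coe_evalPlace_apply`). [cite: PlatonovRapinchuk1994, §5.1] -/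
theorem finAdelicToAdelic_mem_borelAdelic_iff_forall_evalPlace (b : finAdelic F E c N ((StdForm.antidiagonal N).over E)) :
    finAdelicToAdelic F E c N ((StdForm.antidiagonal N).over E) b ∈ borelAdelic F E c N ↔
      ∀ (v : HeightOneSpectrum (𝓞 F)) (w : PlacesOver E v),
        ((((evalPlace F E c N ((StdForm.antidiagonal N).over E) v b : localPi E c N ((StdForm.antidiagonal N).over E) v) : LocalGLPi E N v) w :
          GL (Fin N) (w.1.adicCompletion E)) : Matrix (Fin N) (Fin N) (w.1.adicCompletion E)).BlockTriangular id := by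
  rw [finAdelicToAdelic_mem_borelAdelic_iff_forall_evalAt]
  constructor
  · intro h v w
    rw [coe_evalPlace_apply]
    exact h w.1
  · intro h w
    have := h (w.under (𝓞 F)) ⟨w, rfl⟩
    rwa [coe_evalPlace_apply] at this

/-! ## §2 `k ∈ K_f(𝔫)` is a placewise condition (over the places of `F`) -/

/-- **`k ∈ K_f(𝔫)` iff for every finite place `v` of `F` and every `w ∣ v` the `w`-component of `k_v = evalPlace v k` lies in `K_w(|𝔫|_w)`** (★ `mem_finCongruenceLevel_iff_forall` re-indexed;
general form `J`). [cite: PlatonovRapinchuk1994, §5.1] -/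
theorem mem_finCongruenceLevel_iff_forall_evalPlace (J : Matrix (Fin N) (Fin N) E) (𝔫 : Ideal (𝓞 E)) (k : finAdelic F E c N J) :
    k ∈ finCongruenceLevel F E c N J 𝔫 ↔
      ∀ (v : HeightOneSpectrum (𝓞 F)) (w : PlacesOver E v),
        ((evalPlace F E c N J v k : localPi E c N J v) : LocalGLPi E N v) w ∈ valuedCongruenceSubgroup (Fin N) (idealRadius E w.1 𝔫) := by
  rw [mem_finCongruenceLevel_iff_forall]
  constructor
  · intro h v w
    rw [coe_evalPlace_apply]
    exact h w.1
  · intro h w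
    have := h (w.under (𝓞 F)) ⟨w, rfl⟩
    rwa [coe_evalPlace_apply] at this

/-! ## §3 «⇒»: the components of `u = b·k` -/

/-- **«⇒»**: if `u = b·k` with `ι_f b ∈ B(𝔸_F)` and `k ∈ K_f(𝔫)`, then at every finite place `v` of `F`, `u_v = β·κ` in `U(F_v)` with `β := b_v` upper triangular at every `w ∣ v` and `κ := k_v`,
`κ_w ∈ K_w(|𝔫|_w)` for every `w ∣ v`. [cite: BorelJacquet1979, §4.1] -/
theorem forall_exists_borel_mul_level_of_eq_mul (𝔫 : Ideal (𝓞 E)) {u b k : finAdelic F E c N ((StdForm.antidiagonal N).over E)}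
    (hb : finAdelicToAdelic F E c N ((StdForm.antidiagonal N).over E) b ∈ borelAdelic F E c N) (hk : k ∈ finCongruenceLevel F E c N ((StdForm.antidiagonal N).over E) 𝔫)
    (hu : u = b * k) (v : HeightOneSpectrum (𝓞 F)) :
    ∃ β κ : localPi E c N ((StdForm.antidiagonal N).over E) v,
      (∀ w : PlacesOver E v, ((((β : localPi E c N ((StdForm.antidiagonal N).over E) v) : LocalGLPi E N v) w : GL (Fin N) (w.1.adicCompletion E)) :
        Matrix (Fin N) (Fin N) (w.1.adicCompletion E)).BlockTriangular id) ∧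
      (∀ w : PlacesOver E v, ((κ : localPi E c N ((StdForm.antidiagonal N).over E) v) : LocalGLPi E N v) w ∈ valuedCongruenceSubgroup (Fin N) (idealRadius E w.1 𝔫)) ∧
      evalPlace F E c N ((StdForm.antidiagonal N).over E) v u = β * κ :=
  ⟨evalPlace F E c N _ v b, evalPlace F E c N _ v k, fun w => (finAdelicToAdelic_mem_borelAdelic_iff_forall_evalPlace F E c N b).1 hb v w,
    fun w => (mem_finCongruenceLevel_iff_forall_evalPlace F E c N _ 𝔫 k).1 hk v w, by rw [hu, map_mul]⟩

/-! ## §4 «⇐»: restricted-product assembly of the local Borel factors -/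

/-- `evalPlace v (finAdelicEquiv⁻¹ x) = x_v` (the `v`-component of the element assembled from a restricted family). [cite: PlatonovRapinchuk1994, §5.1] -/
theorem evalPlace_finAdelicEquiv_symm (J : Matrix (Fin N) (Fin N) E) (x : Πʳ v : HeightOneSpectrum (𝓞 F), [localPi E c N J v, localInt E c N J v]) (v : HeightOneSpectrum (𝓞 F)) :
    evalPlace F E c N J v ((finAdelicEquiv F E c N J).symm x) = x v := by
  change finAdelicEquiv F E c N J ((finAdelicEquiv F E c N J).symm x) v = x v
  rw [ContinuousMulEquiv.apply_symm_apply]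

/-- `evalPlace v g = (finAdelicEquiv g)_v` (definitional). [cite: PlatonovRapinchuk1994, §5.1] -/
theorem evalPlace_eq_finAdelicEquiv_apply (J : Matrix (Fin N) (Fin N) E) (g : finAdelic F E c N J) (v : HeightOneSpectrum (𝓞 F)) :
    evalPlace F E c N J v g = finAdelicEquiv F E c N J g v := rfl

/-- **«⇐» WITH PRESCRIBED COMPONENTS (restricted-product assembly).**  Given FAMILIES `β_v, κ_v ∈ U(F_v)` over all finite places `v` of `F` with `β_v` upper triangular at every `w ∣ v`,
`(κ_v)_w ∈ K_w(|𝔫|_w)` for every `w ∣ v`, and `u_v = β_v·κ_v`: there are `b, k ∈ U(𝔸_{F,f})` with `ι_f b ∈ B(𝔸_F)`, `k ∈ K_f(𝔫)`, `u = b·k` AND `b_v = β_v`, `k_v = κ_v` AT EVERY `v` —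
`β_v = u_v κ_v⁻¹ ∈ U(𝒪_v)` for almost all `v` (★ `eventually_evalPlace_mem_localInt`, `K_w ≤ GL_N(𝒪_w)`), so `b := finAdelicEquiv⁻¹ (β_v)_v` exists, and `k := b⁻¹ u`.  (So the global
Borel factor READS the chosen local Iwasawa data place by place — the entry (3)(iii) evaluates.)  No hypothesis on `𝔫`. [cite: PlatonovRapinchuk1994, §5.1] [cite: BorelJacquet1979, §4.1] -/
theorem exists_borel_mul_level_evalPlace_eq (𝔫 : Ideal (𝓞 E)) (u : finAdelic F E c N ((StdForm.antidiagonal N).over E))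
    (β κ : ∀ v : HeightOneSpectrum (𝓞 F), localPi E c N ((StdForm.antidiagonal N).over E) v)
    (hβ : ∀ (v : HeightOneSpectrum (𝓞 F)) (w : PlacesOver E v), ((((β v : localPi E c N ((StdForm.antidiagonal N).over E) v) : LocalGLPi E N v) w : GL (Fin N) (w.1.adicCompletion E)) :
        Matrix (Fin N) (Fin N) (w.1.adicCompletion E)).BlockTriangular id)
    (hκ : ∀ (v : HeightOneSpectrum (𝓞 F)) (w : PlacesOver E v), ((κ v : localPi E c N ((StdForm.antidiagonal N).over E) v) : LocalGLPi E N v) w ∈ valuedCongruenceSubgroup (Fin N) (idealRadius E w.1 𝔫))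
    (hu : ∀ v : HeightOneSpectrum (𝓞 F), evalPlace F E c N ((StdForm.antidiagonal N).over E) v u = β v * κ v) :
    ∃ b k : finAdelic F E c N ((StdForm.antidiagonal N).over E),
      finAdelicToAdelic F E c N ((StdForm.antidiagonal N).over E) b ∈ borelAdelic F E c N ∧ k ∈ finCongruenceLevel F E c N ((StdForm.antidiagonal N).over E) 𝔫 ∧ u = b * k ∧
      (∀ v, evalPlace F E c N ((StdForm.antidiagonal N).over E) v b = β v) ∧ ∀ v, evalPlace F E c N ((StdForm.antidiagonal N).over E) v k = κ v := by
  -- `β_v ∈ U(𝒪_v)` for almost all `v`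
  have hβint : ∀ᶠ v : HeightOneSpectrum (𝓞 F) in cofinite, β v ∈ localInt E c N ((StdForm.antidiagonal N).over E) v := by
    filter_upwards [eventually_evalPlace_mem_localInt F E c N ((StdForm.antidiagonal N).over E) u] with v hv
    have hκint : κ v ∈ localInt E c N ((StdForm.antidiagonal N).over E) v :=
      (mem_localInt_iff E c N _ v (κ v)).2 fun w => valuedCongruenceSubgroup_le_glInt E N w.1 _ (hκ v w)
    have hβeq : β v = evalPlace F E c N ((StdForm.antidiagonal N).over E) v u * (κ v)⁻¹ := by rw [hu v, mul_inv_cancel_right]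
    rw [hβeq]
    exact Subgroup.mul_mem _ hv (Subgroup.inv_mem _ hκint)
  set x : Πʳ v : HeightOneSpectrum (𝓞 F), [localPi E c N ((StdForm.antidiagonal N).over E) v, localInt E c N ((StdForm.antidiagonal N).over E) v] :=
    RestrictedProduct.mk (fun v => β v) hβint with hx
  set b : finAdelic F E c N ((StdForm.antidiagonal N).over E) := (finAdelicEquiv F E c N ((StdForm.antidiagonal N).over E)).symm x with hbdef
  have hbv : ∀ v, evalPlace F E c N ((StdForm.antidiagonal N).over E) v b = β v := fun v => by
    rw [hbdef, evalPlace_finAdelicEquiv_symm, hx, RestrictedProduct.mk_apply]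
  have hkv : ∀ v, evalPlace F E c N ((StdForm.antidiagonal N).over E) v (b⁻¹ * u) = κ v := fun v => by
    rw [map_mul, map_inv, hbv v, hu v, inv_mul_cancel_left]
  refine ⟨b, b⁻¹ * u, ?_, ?_, (mul_inv_cancel_left b u).symm, hbv, hkv⟩
  · rw [finAdelicToAdelic_mem_borelAdelic_iff_forall_evalPlace]
    intro v w
    rw [hbv v]
    exact hβ v w
  · rw [mem_finCongruenceLevel_iff_forall_evalPlace]
    intro v w
    rw [hkv v]
    exact hκ v w

/-- **«⇐» (restricted-product assembly, existential form).**  If at every finite place `v` of `F`, `u_v = β·κ` in `U(F_v)` with `β` upper triangular at every `w ∣ v` and `κ_w ∈ K_w(|𝔫|_w)` for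
every `w ∣ v`, then `u = b·k` with `ι_f b ∈ B(𝔸_F)` and `k ∈ K_f(𝔫)` (choose the local factors, then `exists_borel_mul_level_evalPlace_eq`).  No hypothesis on `𝔫`. [cite: PlatonovRapinchuk1994, §5.1] -/
theorem exists_borel_mul_level_of_forall (𝔫 : Ideal (𝓞 E)) (u : finAdelic F E c N ((StdForm.antidiagonal N).over E))
    (h : ∀ v : HeightOneSpectrum (𝓞 F), ∃ β κ : localPi E c N ((StdForm.antidiagonal N).over E) v,
      (∀ w : PlacesOver E v, ((((β : localPi E c N ((StdForm.antidiagonal N).over E) v) : LocalGLPi E N v) w : GL (Fin N) (w.1.adicCompletion E)) :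
        Matrix (Fin N) (Fin N) (w.1.adicCompletion E)).BlockTriangular id) ∧
      (∀ w : PlacesOver E v, ((κ : localPi E c N ((StdForm.antidiagonal N).over E) v) : LocalGLPi E N v) w ∈ valuedCongruenceSubgroup (Fin N) (idealRadius E w.1 𝔫)) ∧
      evalPlace F E c N ((StdForm.antidiagonal N).over E) v u = β * κ) :
    ∃ b k : finAdelic F E c N ((StdForm.antidiagonal N).over E),
      finAdelicToAdelic F E c N ((StdForm.antidiagonal N).over E) b ∈ borelAdelic F E c N ∧ k ∈ finCongruenceLevel F E c N ((StdForm.antidiagonal N).over E) 𝔫 ∧ u = b * k := by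
  choose β κ hβ hκ hu using h
  obtain ⟨b, k, hb, hk, hbk, -, -⟩ := exists_borel_mul_level_evalPlace_eq F E c N 𝔫 u β κ hβ hκ hu
  exact ⟨b, k, hb, hk, hbk⟩

/-! ## §5 HEAD: the local–global bridge, and its (supp-off) twin -/

/-- **HEAD.  `u ∈ B_f·K_f(𝔫) ⟺ ∀ v, u_v ∈ B_v·K_v(𝔫)`**: a finite-adelic point `u` of the quasi-split unitary group is `b·k` with `ι_f b ∈ B(𝔸_F)` (★ `borelAdelic`) and `k ∈ K_f(𝔫)` (★
`finCongruenceLevel 𝔫`) iff at every finite place `v` of `F` its component `u_v ∈ U(F_v)` (★ `evalPlace`) is `β·κ` with `β ∈ U(F_v)` upper triangular at every `w ∣ v` and `κ ∈ U(F_v)` with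
`κ_w ∈ K_w(|𝔫|_w)` for every `w ∣ v`.  (The left side is the support clause of ★ (E-supp) `exists_finLevelSection_with_support`; no hypothesis on `𝔫`.) [cite: PlatonovRapinchuk1994, §5.1]
[cite: BorelJacquet1979, §4.1] -/
theorem exists_borel_mul_level_iff_forall_evalPlace (𝔫 : Ideal (𝓞 E)) (u : finAdelic F E c N ((StdForm.antidiagonal N).over E)) :
    (∃ b k : finAdelic F E c N ((StdForm.antidiagonal N).over E),
        finAdelicToAdelic F E c N ((StdForm.antidiagonal N).over E) b ∈ borelAdelic F E c N ∧ k ∈ finCongruenceLevel F E c N ((StdForm.antidiagonal N).over E) 𝔫 ∧ u = b * k) ↔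
      ∀ v : HeightOneSpectrum (𝓞 F), ∃ β κ : localPi E c N ((StdForm.antidiagonal N).over E) v,
        (∀ w : PlacesOver E v, ((((β : localPi E c N ((StdForm.antidiagonal N).over E) v) : LocalGLPi E N v) w : GL (Fin N) (w.1.adicCompletion E)) :
          Matrix (Fin N) (Fin N) (w.1.adicCompletion E)).BlockTriangular id) ∧
        (∀ w : PlacesOver E v, ((κ : localPi E c N ((StdForm.antidiagonal N).over E) v) : LocalGLPi E N v) w ∈ valuedCongruenceSubgroup (Fin N) (idealRadius E w.1 𝔫)) ∧
        evalPlace F E c N ((StdForm.antidiagonal N).over E) v u = β * κ :=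
  ⟨fun ⟨_, _, hb, hk, hu⟩ v => forall_exists_borel_mul_level_of_eq_mul F E c N 𝔫 hb hk hu v, exists_borel_mul_level_of_forall F E c N 𝔫 u⟩

/-- **(supp-off) twin.**  `u` lies OFF `B_f·K_f(𝔫)` — in the letters of ★ (E-supp): `∀ b k, ι_f b ∈ B(𝔸_F) → k ∈ K_f(𝔫) → u ≠ b·k` — iff at SOME finite place `v` of `F` the component `u_v` lies off
`B_v·K_v(𝔫)`. [cite: PlatonovRapinchuk1994, §5.1] -/
theorem forall_ne_borel_mul_level_iff_exists_place (𝔫 : Ideal (𝓞 E)) (u : finAdelic F E c N ((StdForm.antidiagonal N).over E)) :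
    (∀ b k : finAdelic F E c N ((StdForm.antidiagonal N).over E),
        finAdelicToAdelic F E c N ((StdForm.antidiagonal N).over E) b ∈ borelAdelic F E c N → k ∈ finCongruenceLevel F E c N ((StdForm.antidiagonal N).over E) 𝔫 → u ≠ b * k) ↔
      ∃ v : HeightOneSpectrum (𝓞 F), ∀ β κ : localPi E c N ((StdForm.antidiagonal N).over E) v,
        (∀ w : PlacesOver E v, ((((β : localPi E c N ((StdForm.antidiagonal N).over E) v) : LocalGLPi E N v) w : GL (Fin N) (w.1.adicCompletion E)) :
          Matrix (Fin N) (Fin N) (w.1.adicCompletion E)).BlockTriangular id) →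
        (∀ w : PlacesOver E v, ((κ : localPi E c N ((StdForm.antidiagonal N).over E) v) : LocalGLPi E N v) w ∈ valuedCongruenceSubgroup (Fin N) (idealRadius E w.1 𝔫)) →
        evalPlace F E c N ((StdForm.antidiagonal N).over E) v u ≠ β * κ := by
  have key := (exists_borel_mul_level_iff_forall_evalPlace F E c N 𝔫 u).not
  simp only [not_exists, not_and, not_forall] at key
  exact key

/-! ## §6 For `𝔫 ≠ 0`: almost every component lies in `K_v(𝔫)`, and the indicator of `B_f·K_f(𝔫)` factorises -/

/-- **Almost every component lies in the level** (`𝔫 ≠ 0`): for all but finitely many finite places `v` of `F`, `(u_v)_w ∈ K_w(|𝔫|_w)` for every `w ∣ v` — since `u_v ∈ U(𝒪_v)` for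
almost all `v` (★ `eventually_evalPlace_mem_localInt`), only finitely many `w` divide `𝔫` (★ `Ideal.finite_factors`), `|𝔫|_w = 1` off them (★ `idealRadius_eq_one_of_not_dvd`) and
`GL_N(𝒪_w) = K_w(1)`. [cite: PlatonovRapinchuk1994, §5.1] -/
theorem eventually_forall_evalPlace_mem_valuedCongruenceSubgroup (J : Matrix (Fin N) (Fin N) E) {𝔫 : Ideal (𝓞 E)} (h𝔫 : 𝔫 ≠ 0) (u : finAdelic F E c N J) :
    ∀ᶠ v : HeightOneSpectrum (𝓞 F) in cofinite, ∀ w : PlacesOver E v,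
      ((evalPlace F E c N J v u : localPi E c N J v) : LocalGLPi E N v) w ∈ valuedCongruenceSubgroup (Fin N) (idealRadius E w.1 𝔫) := by
  -- the finitely many places of `F` under a divisor of `𝔫`
  have hfin : {v : HeightOneSpectrum (𝓞 F) | ∃ w : PlacesOver E v, w.1.asIdeal ∣ 𝔫}.Finite := by
    refine ((Ideal.finite_factors h𝔫).image fun w : HeightOneSpectrum (𝓞 E) => w.under (𝓞 F)).subset ?_
    rintro v ⟨w, hw⟩
    exact ⟨w.1, hw, w.2⟩
  have hrad : ∀ᶠ v : HeightOneSpectrum (𝓞 F) in cofinite, ∀ w : PlacesOver E v, idealRadius E w.1 𝔫 = 1 := by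
    refine hfin.compl_mem_cofinite |> fun h => Filter.mem_of_superset h ?_
    intro v hv w
    exact idealRadius_eq_one_of_not_dvd h𝔫 fun hw => hv ⟨w, hw⟩
  filter_upwards [eventually_evalPlace_mem_localInt F E c N J u, hrad] with v hv hv1 w
  rw [hv1 w]
  exact glInt_le_valuedCongruenceSubgroup_one E N w.1 ((mem_localInt_iff E c N J v _).1 hv w)

/-- Hence (`𝔫 ≠ 0`) **`u_v ∈ B_v·K_v(𝔫)` for almost every `v`** (with `β = 1`, `κ = u_v`). [cite: PlatonovRapinchuk1994, §5.1] -/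
theorem eventually_exists_borel_mul_level_evalPlace (J : Matrix (Fin N) (Fin N) E) {𝔫 : Ideal (𝓞 E)} (h𝔫 : 𝔫 ≠ 0) (u : finAdelic F E c N J) :
    ∀ᶠ v : HeightOneSpectrum (𝓞 F) in cofinite, ∃ β κ : localPi E c N J v,
      (∀ w : PlacesOver E v, ((((β : localPi E c N J v) : LocalGLPi E N v) w : GL (Fin N) (w.1.adicCompletion E)) : Matrix (Fin N) (Fin N) (w.1.adicCompletion E)).BlockTriangular id) ∧
      (∀ w : PlacesOver E v, ((κ : localPi E c N J v) : LocalGLPi E N v) w ∈ valuedCongruenceSubgroup (Fin N) (idealRadius E w.1 𝔫)) ∧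
      evalPlace F E c N J v u = β * κ := by
  filter_upwards [eventually_forall_evalPlace_mem_valuedCongruenceSubgroup F E c N J h𝔫 u] with v hv
  refine ⟨1, evalPlace F E c N J v u, fun w => ?_, hv, (one_mul _).symm⟩
  rw [OneMemClass.coe_one, Pi.one_apply, Units.val_one]
  exact Matrix.blockTriangular_one

open Classical in
/-- **The indicator of `B_f·K_f(𝔫)` is the finite product of the local indicators** (`𝔫 ≠ 0`): `𝟙_{B_f·K_f(𝔫)}(u) = ∏ᶠ_v 𝟙_{B_v·K_v(𝔫)}(u_v)` in `ℂ` — the support factor of the pure-tensor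
reading `Ω = ∏ᶠ_v ω_v` (★ p864589's letter `hΩ`).  By §5 and §6: if `u ∈ B_f·K_f(𝔫)` every local factor is `1`; if not, some local factor is `0` and only finitely many differ from `1`.
[cite: PlatonovRapinchuk1994, §5.1] [cite: BorelJacquet1979, §4.1] -/
theorem ite_exists_borel_mul_level_eq_finprod {𝔫 : Ideal (𝓞 E)} (h𝔫 : 𝔫 ≠ 0) (u : finAdelic F E c N ((StdForm.antidiagonal N).over E)) :
    (if ∃ b k : finAdelic F E c N ((StdForm.antidiagonal N).over E),
        finAdelicToAdelic F E c N ((StdForm.antidiagonal N).over E) b ∈ borelAdelic F E c N ∧ k ∈ finCongruenceLevel F E c N ((StdForm.antidiagonal N).over E) 𝔫 ∧ u = b * k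
      then (1 : ℂ) else 0) =
      ∏ᶠ v : HeightOneSpectrum (𝓞 F), (if ∃ β κ : localPi E c N ((StdForm.antidiagonal N).over E) v,
        (∀ w : PlacesOver E v, ((((β : localPi E c N ((StdForm.antidiagonal N).over E) v) : LocalGLPi E N v) w : GL (Fin N) (w.1.adicCompletion E)) :
          Matrix (Fin N) (Fin N) (w.1.adicCompletion E)).BlockTriangular id) ∧
        (∀ w : PlacesOver E v, ((κ : localPi E c N ((StdForm.antidiagonal N).over E) v) : LocalGLPi E N v) w ∈ valuedCongruenceSubgroup (Fin N) (idealRadius E w.1 𝔫)) ∧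
        evalPlace F E c N ((StdForm.antidiagonal N).over E) v u = β * κ then (1 : ℂ) else 0) := by
  by_cases hglob : ∃ b k : finAdelic F E c N ((StdForm.antidiagonal N).over E),
      finAdelicToAdelic F E c N ((StdForm.antidiagonal N).over E) b ∈ borelAdelic F E c N ∧ k ∈ finCongruenceLevel F E c N ((StdForm.antidiagonal N).over E) 𝔫 ∧ u = b * k
  · -- every local factor is `1`
    rw [if_pos hglob]
    refine (finprod_eq_one_of_forall_eq_one fun v => ?_).symm
    rw [if_pos ((exists_borel_mul_level_iff_forall_evalPlace F E c N 𝔫 u).1 hglob v)]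
  · -- some local factor is `0`, and only finitely many local factors differ from `1`
    rw [if_neg hglob]
    obtain ⟨v₀, hv₀⟩ := (forall_ne_borel_mul_level_iff_exists_place F E c N 𝔫 u).1 fun b k hb hk hu => hglob ⟨b, k, hb, hk, hu⟩
    refine (finprod_eq_zero _ v₀ (if_neg ?_) ?_).symm
    · rintro ⟨β, κ, hβ, hκ, hu⟩
      exact hv₀ β κ hβ hκ hu
    · -- off the finite exceptional set of §6 every local factor is `1`
      have hev := eventually_exists_borel_mul_level_evalPlace F E c N ((StdForm.antidiagonal N).over E) h𝔫 u
      rw [Filter.eventually_cofinite] at hev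
      exact hev.subset fun v hv hP => (Function.mem_mulSupport.1 hv) (if_pos hP)

end General

/-! ## §7 The CM `N = 3` heads at the S8 tokens (`F = L⁺`, `c` = complex conjugation, `U(2,1)`) -/

section CM

variable (L : Type) [Field L] [NumberField L] [IsCMField L]

/-- **HEAD at the S8 tokens** (`U(2,1)_{L/L⁺}`, any level `𝔫 ⊴ 𝓞_L`): `u ∈ B_f·K_f(𝔫) ⟺ ∀ v, u_v ∈ B_v·K_v(𝔫)` — §5 `exists_borel_mul_level_iff_forall_evalPlace` at `F := L⁺`, `E := L`, `c :=` complex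
conjugation, `N := 3` (the letters of ★ (E-supp) `R90.S8.exists_finLevelSection_with_support` and ★ `K2E1ChiArchA32LevelChoiceU3.exists_levelOfRecord_dvd`). [cite: PlatonovRapinchuk1994, §5.1] -/
theorem exists_borel_mul_level_iff_forall_evalPlace_cm_three (𝔫 : Ideal (𝓞 L))
    (u : finAdelic (↥(maximalRealSubfield L)) L (IsCMField.complexConj L) 3 ((StdForm.antidiagonal 3).over L)) :
    (∃ b k : finAdelic (↥(maximalRealSubfield L)) L (IsCMField.complexConj L) 3 ((StdForm.antidiagonal 3).over L),
        finAdelicToAdelic (↥(maximalRealSubfield L)) L (IsCMField.complexConj L) 3 ((StdForm.antidiagonal 3).over L) b ∈ borelAdelic (↥(maximalRealSubfield L)) L (IsCMField.complexConj L) 3 ∧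
        k ∈ finCongruenceLevel (↥(maximalRealSubfield L)) L (IsCMField.complexConj L) 3 ((StdForm.antidiagonal 3).over L) 𝔫 ∧ u = b * k) ↔
      ∀ v : HeightOneSpectrum (𝓞 ↥(maximalRealSubfield L)), ∃ β κ : localPi L (IsCMField.complexConj L) 3 ((StdForm.antidiagonal 3).over L) v,
        (∀ w : PlacesOver L v, ((((β : localPi L (IsCMField.complexConj L) 3 ((StdForm.antidiagonal 3).over L) v) : LocalGLPi L 3 v) w : GL (Fin 3) (w.1.adicCompletion L)) :
          Matrix (Fin 3) (Fin 3) (w.1.adicCompletion L)).BlockTriangular id) ∧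
        (∀ w : PlacesOver L v, ((κ : localPi L (IsCMField.complexConj L) 3 ((StdForm.antidiagonal 3).over L) v) : LocalGLPi L 3 v) w ∈ valuedCongruenceSubgroup (Fin 3) (idealRadius L w.1 𝔫)) ∧
        evalPlace (↥(maximalRealSubfield L)) L (IsCMField.complexConj L) 3 ((StdForm.antidiagonal 3).over L) v u = β * κ :=
  exists_borel_mul_level_iff_forall_evalPlace (↥(maximalRealSubfield L)) L (IsCMField.complexConj L) 3 𝔫 u

open Classical in
/-- **Indicator factorisation at the S8 tokens** (`𝔫 ≠ 0`): `𝟙_{B_f·K_f(𝔫)}(u) = ∏ᶠ_v 𝟙_{B_v·K_v(𝔫)}(u_v)` for `U(2,1)_{L/L⁺}` — the support factor of ★ p864589's `hΩ` (§6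
`ite_exists_borel_mul_level_eq_finprod` specialised). [cite: PlatonovRapinchuk1994, §5.1] -/
theorem ite_exists_borel_mul_level_eq_finprod_cm_three {𝔫 : Ideal (𝓞 L)} (h𝔫 : 𝔫 ≠ 0)
    (u : finAdelic (↥(maximalRealSubfield L)) L (IsCMField.complexConj L) 3 ((StdForm.antidiagonal 3).over L)) :
    (if ∃ b k : finAdelic (↥(maximalRealSubfield L)) L (IsCMField.complexConj L) 3 ((StdForm.antidiagonal 3).over L),
        finAdelicToAdelic (↥(maximalRealSubfield L)) L (IsCMField.complexConj L) 3 ((StdForm.antidiagonal 3).over L) b ∈ borelAdelic (↥(maximalRealSubfield L)) L (IsCMField.complexConj L) 3 ∧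
        k ∈ finCongruenceLevel (↥(maximalRealSubfield L)) L (IsCMField.complexConj L) 3 ((StdForm.antidiagonal 3).over L) 𝔫 ∧ u = b * k
      then (1 : ℂ) else 0) =
      ∏ᶠ v : HeightOneSpectrum (𝓞 ↥(maximalRealSubfield L)), (if ∃ β κ : localPi L (IsCMField.complexConj L) 3 ((StdForm.antidiagonal 3).over L) v,
        (∀ w : PlacesOver L v, ((((β : localPi L (IsCMField.complexConj L) 3 ((StdForm.antidiagonal 3).over L) v) : LocalGLPi L 3 v) w : GL (Fin 3) (w.1.adicCompletion L)) :
          Matrix (Fin 3) (Fin 3) (w.1.adicCompletion L)).BlockTriangular id) ∧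
        (∀ w : PlacesOver L v, ((κ : localPi L (IsCMField.complexConj L) 3 ((StdForm.antidiagonal 3).over L) v) : LocalGLPi L 3 v) w ∈ valuedCongruenceSubgroup (Fin 3) (idealRadius L w.1 𝔫)) ∧
        evalPlace (↥(maximalRealSubfield L)) L (IsCMField.complexConj L) 3 ((StdForm.antidiagonal 3).over L) v u = β * κ then (1 : ℂ) else 0) :=
  ite_exists_borel_mul_level_eq_finprod (↥(maximalRealSubfield L)) L (IsCMField.complexConj L) 3 h𝔫 u

end CM

end Summit.HodgeConjecture.HodgeConjecture.Cruxes.H413.K2E1FinAdelicBorelLevelLocalGlobalU3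

end
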